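import Literature.NumberTheory.Automorphic.LeviConstantTermForms
import Literature.NumberTheory.Automorphic.ConstantTermBlockGLSmooth
import Literature.NumberTheory.Automorphic.HarishChandraLeviIntegralPlaces
import Literature.NumberTheory.Automorphic.ArchimedeanRightIdealVanishing
import Literature.NumberTheory.Automorphic.ArchimedeanApplyFreeCongr
import HarnessLib

/-!
# `Z(𝔪)`-relations for the Levi functions of a constant term
(Harish-Chandra 1968, §4; Moeglin–Waldspurger 1995, I.2.17; Borel–Jacquet 1979, 4.4)

Topic `NumberTheory/Automorphic`; sequel of `LeviConstantTermForms`, `HarishChandraLeviIntegralPlaces`,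
`ArchimedeanRightIdealVanishing` and `ConstantTermBlockGLDerivatives`. Let `φ` be a smooth function
on `GL_{k+l}(𝔸_K)` with `Z(𝔤)`-character `θ` and let `ψ = φ_P` be its constant term along the maximal
parabolic `P_k = M N` (left `N(𝔸_K)`-invariant, smooth, again of character `θ`). The classical
argument (Harish-Chandra 1968, §4; Moeglin–Waldspurger I.2.17) that the Levi functions
`m₁ ↦ ψ (diag(m₁, m₂))` are `Z(𝔪)`-finite is carried out here, in the following explicit form.

* `applyFree_eq_zero_of_envToMat_mem_uRightR` — **vanishing of `𝔲·U` on `N(𝔸)`-invariant smooth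
  functions at points of `P(𝔸)`**: a word whose image in `U(𝔤𝔩_{k+l}(K_∞))` lies in the right ideal
  `𝔲·U` (`HCLevi.uRightR`) kills `ψ` at every `p ∈ P_k(𝔸_K)` (the one-parameter groups of `𝔲`
  through `p` stay in `N(𝔸)`, `ofInfinite_expGL_eq_unipotentOfBlock`, and
  `applyFree_apply_eq_zero_of_mem_rightSpan`);
* `HasZCharacter.applyFree_central_mul` — a central word `w` followed by any word `r` acts on a
  smooth `ψ` of character `θ` by `θ(w) · (r ψ)`;
* `sum_applyFree_pow_leviFunLeft_eq_zero` / `_Right` — **the relation on the Levi**: from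
  Harish-Chandra's integrality `A^d + ∑_{i<d} C_i A^i ∈ 𝔲·U` (`A = diag(ζ, 0)` for `ζ` central in
  `U(𝔤𝔩_k(K_∞))`, `C_i ∈ Z(𝔤𝔩_{k+l}(K_∞))`, `HarishChandraLeviIntegralPlaces`) one gets, for
  the Levi function `L = leviFunLeft ψ m₂` and a word `q` over `𝔤𝔩_k` representing `ζ`,
  `∑_{i ≤ d} a_i (q^i L)(m₁) = 0` with `a_d = 1`, `a_i = θ(C_i)`;
* `applyFree_eq_zero_of_sum_applyFree_pow_eq_zero` — **from such a complex monic relation to a real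
  one** (general archimedean datum): with `Q_a = ∑_{i,j ≤ d} Re(a_i ā_j) X^{i+j} ∈ ℝ[X]` (monic of
  degree `2d`, `normPoly_monic`; it is `u ū` for `u = ∑ a_i X^i`), every word whose image in `U(𝔤)` is
  a multiple of `Q_a(ζ)` kills `L`;
* `exists_monic_forall_leviFunLeft_realPlace` (and the `Right`/complex-place variants) — **for every
  real (complex) place `w`, every central `z ∈ Z(U(𝔤𝔩_k))` over `ℝ` (`ℂ`) and every character `θ` of
  `Z(𝔤𝔩_{k+l}(K_∞))` there is a monic `Q ∈ ℝ[X]` such that for every automorphic form `φ` on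
  `GL_{k+l}(𝔸_K)` of character `θ`, every Haar measure on the box and every `m₂`, each word over
  `𝔤𝔩_k(K_∞)` whose image is a multiple of `Q(z_w)` kills `leviFunLeft φ_P m₂`** — the input of the
  finite-codimensional ideal of `Z(𝔤𝔩_k(K_∞))` annihilating all these Levi functions
  (Borel–Jacquet 1979, 4.4: "`φ_P` is `Z(𝔪)`-finite"; Moeglin–Waldspurger I.2.17).

Everything here is proved; the definitions are `blockNilpotentOfInfinite` and `normPoly`.

## References

* Harish-Chandra, *Automorphic forms on semisimple Lie groups*, LNM 62 (1968), §4, Thm. 4 and its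
  corollary [HarishChandra1968].
* C. Moeglin, J.-L. Waldspurger, *Spectral decomposition and Eisenstein series* (1995), I.2.17
  [MoeglinWaldspurger1995].
* A. Borel, H. Jacquet, *Automorphic forms and automorphic representations* (1979), 4.4
  [BorelJacquet1979].
-/

-- Mathlib idiom (Mathlib/Algebra/Lie/OfAssociative.lean); needed to mention Lie subalgebras of matrix algebras
attribute [local instance 100] LieRing.ofAssociativeRing

noncomputable section

open scoped Matrix MatrixGroups Classical ContDiff ComplexConjugate Polynomial
open NumberField IsDedekindDomain NumberField.mixedEmbedding UniversalEnvelopingAlgebra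
open _root_.MeasureTheory

namespace Literature.NumberTheory.Automorphic

/-! ### 1. From a complex monic relation to a real one (general archimedean datum) -/

section NormPoly

/-- The real polynomial `Q_a = ∑_{i, j ≤ d} Re(a_i ā_j) X^{i+j}`; it equals `u ū` for
`u = ∑_{i ≤ d} a_i X^i`. [folklore] -/
def normPoly (a : ℕ → ℂ) (d : ℕ) : ℝ[X] :=
  ∑ i ∈ Finset.range (d + 1), ∑ j ∈ Finset.range (d + 1),
    Polynomial.C ((a i * conj (a j)).re) * Polynomial.X ^ (i + j)

/-- `Q_a` is monic of degree `2d` when `a_d = 1`. [folklore] -/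
theorem normPoly_monic {a : ℕ → ℂ} {d : ℕ} (ha : a d = 1) : (normPoly a d).Monic := by
  refine Polynomial.monic_of_natDegree_le_of_coeff_eq_one (2 * d) ?_ ?_
  · refine Polynomial.natDegree_sum_le_of_forall_le _ _ fun i hi => ?_
    refine Polynomial.natDegree_sum_le_of_forall_le _ _ fun j hj => ?_
    refine (Polynomial.natDegree_C_mul_X_pow_le _ _).trans ?_
    have hi' := Finset.mem_range.1 hi
    have hj' := Finset.mem_range.1 hj
    omega
  · rw [normPoly, Polynomial.finsetSum_coeff]
    simp only [Polynomial.finsetSum_coeff, Polynomial.coeff_C_mul_X_pow]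
    rw [Finset.sum_eq_single d, Finset.sum_eq_single d]
    · rw [if_pos (by ring), ha, map_one, mul_one, Complex.one_re]
    · intro j hj hjd
      rw [if_neg]
      have := Finset.mem_range.1 hj
      omega
    · intro hd; exact absurd (Finset.mem_range.2 (Nat.lt_succ_self d)) hd
    · intro i hi hid
      refine Finset.sum_eq_zero fun j hj => ?_
      rw [if_neg]
      have := Finset.mem_range.1 hi
      have := Finset.mem_range.1 hj
      omega
    · intro hd; exact absurd (Finset.mem_range.2 (Nat.lt_succ_self d)) hd

variable {A : Type*} [NormedCommRing A] [NormedAlgebra ℝ A] [NormedAlgebra ℚ A] [CompleteSpace A]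
  [StarRing A] [FiniteDimensional ℝ A] {N : Type*} [Fintype N] [DecidableEq N] {H : RealMatrixGroup A N}
  {G : Type*} [Group G] (ι : H.carrier →* G)

/-- **A central word followed by any word acts on a smooth function of character `θ` by
`θ(w) · (r ψ)`**: `(w r) ψ = (r w) ψ = r (θ(w) ψ) = θ(w) (r ψ)` (the word action factors through
`U(𝔤)` on smooth functions, `coe_envelopingAction_freeToEnveloping_of_forall_eq`). [folklore] -/
theorem HasZCharacter.applyFree_central_mul {ψ : G → ℂ} (hψ : IsArchSmooth ι ψ)
    {θ : centerU H →ₐ[ℝ] ℂ} (hθ : HasZCharacter ι ψ θ) {w : FreeAlgebra ℝ H.lie} (hw : IsCentralWord w)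
    (r : FreeAlgebra ℝ H.lie) :
    applyFree ι (w * r) ψ = θ ⟨freeToEnveloping H w, hw⟩ • applyFree ι r ψ := by
  obtain ⟨ρ, hρ⟩ := exists_lieHom_lieDeriv ι
  have hact := coe_envelopingAction_freeToEnveloping_of_forall_eq ρ hρ
  set ψ' : archSmooth ι := ⟨ψ, (mem_archSmooth_iff ι _).2 hψ⟩ with hψ'
  have hcomm : freeToEnveloping H (w * r) = freeToEnveloping H (r * w) := by
    rw [map_mul, map_mul]
    exact (Subalgebra.mem_center_iff.1 hw _).symm
  have h1 : envelopingAction ρ (freeToEnveloping H w) ψ' = θ ⟨freeToEnveloping H w, hw⟩ • ψ' := by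
    refine Subtype.ext ?_
    rw [hact, Submodule.coe_smul, hθ w hw]
  have h2 := hact (w * r) ψ'
  rw [hcomm, map_mul, map_mul, Module.End.mul_apply, h1, map_smul, Submodule.coe_smul, hact] at h2
  exact h2.symm

/-- Real scalars act on `End_ℂ(V)` through `ℝ → ℂ` (the lemma `real_smul_eq_coe_smul_end` of
`UnitaryGroupAutomorphicRep`, not imported). [folklore] -/
private theorem real_smul_eq_coe_smul_end' {V : Type*} [AddCommGroup V] [Module ℂ V] (t : ℝ) (f : Module.End ℂ V) :
    t • f = (t : ℂ) • f := by
  ext v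
  simp [LinearMap.smul_apply, Complex.coe_smul]

/-- **From a complex monic relation `∑_{i ≤ d} a_i (q^i L) = 0`, `a_d = 1`, to the real one
`Q_a(q) L = 0`** and all its multiples: every word whose image in `U(𝔤)` is a (left) multiple of
`Q_a(ζ)`, `ζ` the image of `q`, kills the smooth function `L`. (On the `U(𝔤)`-module of smooth
functions, `Q_a(ζ) = (∑ ā_j ζ^j)(∑ a_i ζ^i)`.) Harish-Chandra 1968, §4 (proof of Thm. 4).
[cite: HarishChandra1968, §4, Theorem 4] -/
theorem applyFree_eq_zero_of_sum_applyFree_pow_eq_zero {L : G → ℂ} (hL : IsArchSmooth ι L)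
    (q : FreeAlgebra ℝ H.lie) (a : ℕ → ℂ) (d : ℕ)
    (hrel : ∀ g, ∑ i ∈ Finset.range (d + 1), a i * applyFree ι (q ^ i) L g = 0)
    {p : FreeAlgebra ℝ H.lie} {r : UniversalEnvelopingAlgebra ℝ H.lie}
    (hp : freeToEnveloping H p = r * Polynomial.aeval (freeToEnveloping H q) (normPoly a d)) :
    applyFree ι p L = 0 := by
  obtain ⟨ρ, hρ⟩ := exists_lieHom_lieDeriv ι
  have hact := coe_envelopingAction_freeToEnveloping_of_forall_eq ρ hρ
  set act : UniversalEnvelopingAlgebra ℝ H.lie →ₐ[ℝ] Module.End ℂ (archSmooth ι) := envelopingAction ρ with hact_def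
  set L' : archSmooth ι := ⟨L, (mem_archSmooth_iff ι _).2 hL⟩ with hL'
  set T : Module.End ℂ (archSmooth ι) := act (freeToEnveloping H q) with hT
  -- `T^i L' = q^i L`
  have hpow : ∀ i, ((((T ^ i) L' : archSmooth ι)) : G → ℂ) = applyFree ι (q ^ i) L := by
    intro i
    rw [hT, ← map_pow, ← map_pow, hact]
  -- the complex relation, at the operator level
  have hTrel : (∑ i ∈ Finset.range (d + 1), a i • T ^ i) L' = 0 := by
    refine Subtype.ext (funext fun g => ?_)
    rw [LinearMap.sum_apply, Submodule.coe_sum, Finset.sum_apply, ZeroMemClass.coe_zero, Pi.zero_apply]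
    simp only [LinearMap.smul_apply, Submodule.coe_smul, Pi.smul_apply, smul_eq_mul, hpow]
    exact hrel g
  -- the real element `Q_a(ζ)` acts by `(∑ ā_j T^j) (∑ a_i T^i)`
  have hQ : act (Polynomial.aeval (freeToEnveloping H q) (normPoly a d)) =
      ∑ i ∈ Finset.range (d + 1), ∑ j ∈ Finset.range (d + 1), (((a i * conj (a j)).re : ℝ) : ℂ) • T ^ (i + j) := by
    rw [← Polynomial.aeval_algHom_apply, normPoly, map_sum]
    refine Finset.sum_congr rfl fun i _ => ?_
    rw [map_sum]
    refine Finset.sum_congr rfl fun j _ => ?_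
    rw [map_mul, Polynomial.aeval_C, map_pow, Polynomial.aeval_X, ← Algebra.smul_def, ← hT,
      real_smul_eq_coe_smul_end']
  have hsym : (∑ i ∈ Finset.range (d + 1), ∑ j ∈ Finset.range (d + 1), (a i * conj (a j)) • T ^ (i + j)) =
      ∑ i ∈ Finset.range (d + 1), ∑ j ∈ Finset.range (d + 1), (((a i * conj (a j)).re : ℝ) : ℂ) • T ^ (i + j) := by
    set S := ∑ i ∈ Finset.range (d + 1), ∑ j ∈ Finset.range (d + 1), (a i * conj (a j)) • T ^ (i + j) with hS
    have hS' : S = ∑ i ∈ Finset.range (d + 1), ∑ j ∈ Finset.range (d + 1), conj (a i * conj (a j)) • T ^ (i + j) := by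
      rw [hS, Finset.sum_comm]
      refine Finset.sum_congr rfl fun i _ => Finset.sum_congr rfl fun j _ => ?_
      rw [map_mul, Complex.conj_conj, mul_comm ((starRingEnd ℂ) (a i)) (a j), add_comm i j]
    have key : S + S = (∑ i ∈ Finset.range (d + 1), ∑ j ∈ Finset.range (d + 1),
        (((a i * conj (a j)).re : ℝ) : ℂ) • T ^ (i + j)) +
        ∑ i ∈ Finset.range (d + 1), ∑ j ∈ Finset.range (d + 1), (((a i * conj (a j)).re : ℝ) : ℂ) • T ^ (i + j) := by
      nth_rewrite 1 [hS']
      rw [hS, ← Finset.sum_add_distrib, ← Finset.sum_add_distrib]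
      refine Finset.sum_congr rfl fun i _ => ?_
      rw [← Finset.sum_add_distrib, ← Finset.sum_add_distrib]
      refine Finset.sum_congr rfl fun j _ => ?_
      rw [← add_smul, ← add_smul, add_comm, Complex.add_conj]
      congr 1
      push_cast
      ring
    rw [← two_smul ℂ, ← two_smul ℂ] at key
    exact (smul_right_inj (two_ne_zero' ℂ)).1 key
  -- conclusion
  have hkill : act (Polynomial.aeval (freeToEnveloping H q) (normPoly a d)) L' = 0 := by
    rw [hQ, ← hsym]
    have hfac : (∑ i ∈ Finset.range (d + 1), ∑ j ∈ Finset.range (d + 1), (a i * conj (a j)) • T ^ (i + j)) =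
        (∑ j ∈ Finset.range (d + 1), conj (a j) • T ^ j) * ∑ i ∈ Finset.range (d + 1), a i • T ^ i := by
      rw [Finset.sum_mul_sum, Finset.sum_comm]
      refine Finset.sum_congr rfl fun i _ => Finset.sum_congr rfl fun j _ => ?_
      rw [smul_mul_smul_comm, ← pow_add]
      congr 1
      · exact mul_comm _ _
      · exact congrArg (fun m => T ^ m) (Nat.add_comm _ _)
    rw [hfac, Module.End.mul_apply, hTrel, map_zero]
  have h := hact p L'
  rw [hp, map_mul, Module.End.mul_apply, hkill, map_zero, ZeroMemClass.coe_zero] at h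
  exact h.symm

end NormPoly

variable {K : Type} [Field K] [NumberField K] {k l : ℕ}

/-! ### 2. One-parameter unipotents of `𝔲` in `GL_{k+l}(𝔸_K)` -/

section Unipotent

variable {n : ℕ}

/-- `𝔲 ⊆ 𝔫_k`: a matrix supported on the upper right block is block nilpotent. [folklore] -/
theorem mem_blockNilpotent_of_mem_uBlockR {R : Type*} [CommRing R] [Algebra ℝ R]
    {X : Matrix (Fin (k + l)) (Fin (k + l)) R} (hX : X ∈ HCLevi.uBlockR (𝕜 := R) k l) :
    X ∈ blockNilpotent (k + l) k R :=
  fun i j h => by by_contra hc; exact h (hX i j hc)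

/-- `exp x = 1 + x` for `x² = 0` in a Banach algebra. [folklore] -/
theorem exp_eq_one_add_of_mul_self_eq_zero {B : Type*} [Ring B] [Algebra ℝ B] [TopologicalSpace B]
    [IsTopologicalRing B] [T2Space B] {x : B} (hx : x * x = 0) : NormedSpace.exp x = 1 + x := by
  rw [NormedSpace.exp_eq_tsum ℝ]
  dsimp only
  rw [tsum_eq_sum (s := Finset.range 2)]
  · simp [Finset.sum_range_succ]
  · intro m hm
    have h2 : 2 ≤ m := by rw [Finset.mem_range, not_lt] at hm; exact hm
    rw [pow_eq_zero_of_le h2 (by rw [pow_two, hx]), smul_zero]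

/-- The adelic block nilpotent matrix with infinite component `M` and finite component `0`.
[folklore] -/
def blockNilpotentOfInfinite (M : blockNilpotent n k (mixedSpace K)) :
    blockNilpotent n k (AdeleRing (𝓞 K) K) :=
  ⟨Matrix.of fun i j =>
      ((InfiniteAdeleRing.ringEquiv_mixedSpace K).symm ((M : Matrix (Fin n) (Fin n) (mixedSpace K)) i j), 0),
    fun i j h => M.2 i j fun h0 => h (by rw [Matrix.of_apply, h0, map_zero]; rfl)⟩

/-- **`(exp M, 1) = 1 + (M, 0)` in `GL_n(𝔸_K)` for `M ∈ 𝔫_k(K_∞)`** (`M² = 0`). [folklore] -/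
theorem ofInfinite_expGL_eq_unipotentOfBlock (M : blockNilpotent n k (mixedSpace K)) :
    GLn.ofInfinite n K (expGL (M : Matrix (Fin n) (Fin n) (mixedSpace K))) =
      unipotentOfBlock n k (AdeleRing (𝓞 K) K) (Multiplicative.ofAdd (blockNilpotentOfInfinite M)) := by
  haveI : T2Space (mixedSpace K) := inferInstance
  have h1 : ((GLn.ofInfinite n K 1 : GL (Fin n) (AdeleRing (𝓞 K) K)) : Matrix (Fin n) (Fin n) (AdeleRing (𝓞 K) K)) = 1 := by
    rw [map_one, Units.val_one]
  refine Units.ext (Matrix.ext fun i j => ?_)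
  rw [coe_unipotentOfBlock, toAdd_ofAdd, Matrix.add_apply, ← h1, GLn.coe_ofInfinite_apply,
    GLn.coe_ofInfinite_apply, coe_expGL, exp_eq_one_add_of_mul_self_eq_zero (blockNilpotent_mul_self M.2 M.2),
    Matrix.add_apply, map_add, Units.val_one]
  change _ = _ + (((InfiniteAdeleRing.ringEquiv_mixedSpace K).symm ((M : Matrix (Fin n) (Fin n) (mixedSpace K)) i j),
    (0 : FiniteAdeleRing (𝓞 K) K)) : AdeleRing (𝓞 K) K)
  exact Prod.ext rfl (add_zero _).symm

/-- **The one-parameter groups of `𝔲` through a point of `P_k(𝔸_K)` stay in `N_k(𝔸_K)`**: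
`p · (exp tX, 1) · p⁻¹ ∈ N_k(𝔸_K)` for `X ∈ 𝔲`, `p ∈ P_k(𝔸_K)`. [folklore] -/
theorem conj_glArch_expMem_mem_range_unipotentOfBlock {p : GL (Fin (k + l)) (AdeleRing (𝓞 K) K)}
    (hp : p ∈ standardParabolicGL (AdeleRing (𝓞 K) K) (maximalParabolicLabel (k + l) k))
    {X : (archGroupGL (k + l) K).lie}
    (hX : (X : Matrix (Fin (k + l)) (Fin (k + l)) (mixedSpace K)) ∈ HCLevi.uBlockR (𝕜 := mixedSpace K) k l) (t : ℝ) :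
    p * glArch (k + l) K ((archGroupGL (k + l) K).expMem (t • X)) * p⁻¹ ∈
      Set.range fun Y : blockNilpotent (k + l) k (AdeleRing (𝓞 K) K) =>
        unipotentOfBlock (k + l) k (AdeleRing (𝓞 K) K) (Multiplicative.ofAdd Y) := by
  have htX : ((t • X : (archGroupGL (k + l) K).lie) : Matrix (Fin (k + l)) (Fin (k + l)) (mixedSpace K)) ∈
      blockNilpotent (k + l) k (mixedSpace K) :=
    mem_blockNilpotent_of_mem_uBlockR (Submodule.smul_mem _ t hX)
  refine ⟨blockNilpotentConj ⟨p, hp⟩ (blockNilpotentOfInfinite ⟨_, htX⟩), ?_⟩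
  dsimp only
  rw [unipotentOfBlock_blockNilpotentConj, ← ofInfinite_expGL_eq_unipotentOfBlock, glArch_apply,
    RealMatrixGroup.coe_expMem]

end Unipotent

/-! ### 3. Vanishing of `𝔲·U` at points of `P(𝔸)` and the relation on `GL_{k+l}` -/

section Vanishing

/-- **A word of `𝔲·U` kills left `N(𝔸)`-invariant smooth functions at points of `P(𝔸)`**: if
`ψ` is smooth in the archimedean variable and left `N_k(𝔸_K)`-invariant, `p ∈ P_k(𝔸_K)` and the
image of the word `P` in `U(𝔤𝔩_{k+l}(K_∞))` lies in the right ideal `𝔲·U`, then `(P ψ)(p) = 0`.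
Harish-Chandra 1968, §4, Cor. of Lemma 17; Moeglin–Waldspurger 1995, I.2.17.
[cite: HarishChandra1968, §4] -/
theorem applyFree_eq_zero_of_envToMat_mem_uRightR {ψ : GL (Fin (k + l)) (AdeleRing (𝓞 K) K) → ℂ}
    (hψs : IsArchSmooth (glArch (k + l) K) ψ)
    (hψN : ∀ (Y : blockNilpotent (k + l) k (AdeleRing (𝓞 K) K)) (g : GL (Fin (k + l)) (AdeleRing (𝓞 K) K)),
      ψ (unipotentOfBlock (k + l) k (AdeleRing (𝓞 K) K) (Multiplicative.ofAdd Y) * g) = ψ g)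
    {p : GL (Fin (k + l)) (AdeleRing (𝓞 K) K)}
    (hp : p ∈ standardParabolicGL (AdeleRing (𝓞 K) K) (maximalParabolicLabel (k + l) k))
    {P : FreeAlgebra ℝ (archGroupGL (k + l) K).lie}
    (hP : envToMat K (k + l) (freeToEnveloping (archGroupGL (k + l) K) P) ∈ HCLevi.uRightR (𝕜 := mixedSpace K) k l) :
    applyFree (glArch (k + l) K) P ψ p = 0 := by
  have hH : (archGroupGL (k + l) K).lie = ⊤ := rfl
  have hc : (archGroupGL (k + l) K).carrier = ⊤ := rfl
  refine applyFree_apply_eq_zero_of_mem_rightSpan (glArch (k + l) K) hH hc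
    (S := Set.range fun Y : blockNilpotent (k + l) k (AdeleRing (𝓞 K) K) =>
      unipotentOfBlock (k + l) k (AdeleRing (𝓞 K) K) (Multiplicative.ofAdd Y))
    (𝔲 := {X : (archGroupGL (k + l) K).lie |
      (X : Matrix (Fin (k + l)) (Fin (k + l)) (mixedSpace K)) ∈ HCLevi.uBlockR (𝕜 := mixedSpace K) k l})
    hψs ?_ ?_ ?_
  · rintro _ ⟨Y, rfl⟩ g
    exact hψN Y g
  · intro X hX t
    exact conj_glArch_expMem_mem_range_unipotentOfBlock hp hX t
  · have h := envOfMat_mem_span_of_mem_uRightR (K := K) hP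
    rwa [envOfMat_envToMat] at h

/-- **The relation on `GL_{k+l}`.** Let `ψ` be smooth, left `N_k(𝔸_K)`-invariant, of character `θ`;
let `A, w_0, …, w_{d-1}` be words with the `w_i` central, such that the image of
`A^d + ∑_{i<d} w_i A^i` in `U(𝔤𝔩_{k+l}(K_∞))` lies in `𝔲·U`. Then at every `p ∈ P_k(𝔸_K)`,
`(A^d ψ)(p) + ∑_{i<d} θ(w_i) (A^i ψ)(p) = 0`. Harish-Chandra 1968, §4, proof of Thm. 4.
[cite: HarishChandra1968, §4, Theorem 4] -/
theorem applyFree_pow_add_sum_eq_zero {ψ : GL (Fin (k + l)) (AdeleRing (𝓞 K) K) → ℂ}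
    (hψs : IsArchSmooth (glArch (k + l) K) ψ)
    (hψN : ∀ (Y : blockNilpotent (k + l) k (AdeleRing (𝓞 K) K)) (g : GL (Fin (k + l)) (AdeleRing (𝓞 K) K)),
      ψ (unipotentOfBlock (k + l) k (AdeleRing (𝓞 K) K) (Multiplicative.ofAdd Y) * g) = ψ g)
    {θ : centerU (archGroupGL (k + l) K) →ₐ[ℝ] ℂ} (hθ : HasZCharacter (glArch (k + l) K) ψ θ)
    (A : FreeAlgebra ℝ (archGroupGL (k + l) K).lie) {d : ℕ}
    (w : ℕ → FreeAlgebra ℝ (archGroupGL (k + l) K).lie) (hw : ∀ i, IsCentralWord (w i))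
    (hmem : envToMat K (k + l) (freeToEnveloping (archGroupGL (k + l) K)
      (A ^ d + ∑ i ∈ Finset.range d, w i * A ^ i)) ∈ HCLevi.uRightR (𝕜 := mixedSpace K) k l)
    {p : GL (Fin (k + l)) (AdeleRing (𝓞 K) K)}
    (hp : p ∈ standardParabolicGL (AdeleRing (𝓞 K) K) (maximalParabolicLabel (k + l) k)) :
    applyFree (glArch (k + l) K) (A ^ d) ψ p +
      ∑ i ∈ Finset.range d, θ ⟨freeToEnveloping (archGroupGL (k + l) K) (w i), hw i⟩ *
        applyFree (glArch (k + l) K) (A ^ i) ψ p = 0 := by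
  have h := applyFree_eq_zero_of_envToMat_mem_uRightR hψs hψN hp hmem
  rw [applyFree_add, Pi.add_apply] at h
  rw [← h]
  congr 1
  -- the sum, term by term
  have hsum : ∀ s : Finset ℕ, applyFree (glArch (k + l) K) (∑ i ∈ s, w i * A ^ i) ψ =
      ∑ i ∈ s, θ ⟨freeToEnveloping (archGroupGL (k + l) K) (w i), hw i⟩ • applyFree (glArch (k + l) K) (A ^ i) ψ := by
    intro s
    induction s using Finset.induction_on with
    | empty =>
      rw [Finset.sum_empty, Finset.sum_empty]
      unfold applyFree
      rw [map_zero, Finsupp.sum_zero_index]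
    | insert i s hi ih =>
      rw [Finset.sum_insert hi, Finset.sum_insert hi, applyFree_add, ih,
        HasZCharacter.applyFree_central_mul (glArch (k + l) K) hψs hθ (hw i)]
  rw [hsum, Finset.sum_apply]
  simp only [Pi.smul_apply, smul_eq_mul]

end Vanishing

/-! ### 4. Transfer to the Levi: the relation for the Levi functions of a constant term -/

section Levi

/-- A preimage under `freeToEnveloping`. [folklore] -/
theorem freeToEnveloping_surjective_gl (m : ℕ) :
    Function.Surjective (freeToEnveloping (archGroupGL m K)) := by
  -- the proof of `freeToEnveloping_surjective` of `AutomorphicRepsGLCuspidalSpectralSupport` (not imported)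
  have hrange : (freeToEnveloping (archGroupGL m K)).range = ⊤ := by
    rw [freeToEnveloping, ← Algebra.adjoin_range_eq_range_freeAlgebra_lift]
    have hι : Set.range (UniversalEnvelopingAlgebra.ι ℝ : (archGroupGL m K).lie →
        UniversalEnvelopingAlgebra ℝ (archGroupGL m K).lie) =
        UniversalEnvelopingAlgebra.mkAlgHom ℝ (archGroupGL m K).lie '' Set.range (TensorAlgebra.ι ℝ (M := (archGroupGL m K).lie)) := by
      rw [← Set.range_comp]
      rfl
    rw [hι, ← AlgHom.map_adjoin, TensorAlgebra.adjoin_range_ι, Algebra.map_top, AlgHom.range_eq_top]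
    exact RingCon.mkₐ_surjective _
  intro u
  have hu : u ∈ (freeToEnveloping (archGroupGL m K)).range := hrange ▸ Algebra.mem_top
  exact hu

set_option maxHeartbeats 400000 in
/-- **The `Z(𝔪)`-relation for the first Levi function** (abstract form). Let `ψ` on `GL_{k+l}(𝔸_K)`
be smooth, left `N_k(𝔸_K)`-invariant, of character `θ`. Let `ζ ∈ U(𝔤𝔩_k(K_∞))` and central
`C_0, …, C_{d-1} ∈ Z(U(𝔤𝔩_{k+l}(K_∞)))` with `diag(ζ,0)^d + ∑_{i<d} C_i diag(ζ,0)^i ∈ 𝔲·U`, and let `q`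
be a word over `𝔤𝔩_k(K_∞)` representing `ζ`. Then for all `m₁, m₂`,
`∑_{i ≤ d} a_i (q^i (leviFunLeft ψ m₂))(m₁) = 0` with `a_d = 1`, `a_i = θ(C_i)` (`i < d`).
Harish-Chandra 1968, §4, Thm. 4; Moeglin–Waldspurger 1995, I.2.17. [cite: MoeglinWaldspurger1995, I.2.17] -/
theorem sum_applyFree_pow_leviFunLeft_eq_zero {ψ : GL (Fin (k + l)) (AdeleRing (𝓞 K) K) → ℂ}
    (hψs : IsArchSmooth (glArch (k + l) K) ψ)
    (hψN : ∀ (Y : blockNilpotent (k + l) k (AdeleRing (𝓞 K) K)) (g : GL (Fin (k + l)) (AdeleRing (𝓞 K) K)),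
      ψ (unipotentOfBlock (k + l) k (AdeleRing (𝓞 K) K) (Multiplicative.ofAdd Y) * g) = ψ g)
    {θ : centerU (archGroupGL (k + l) K) →ₐ[ℝ] ℂ} (hθ : HasZCharacter (glArch (k + l) K) ψ θ)
    {q : FreeAlgebra ℝ (archGroupGL k K).lie} {ζ : UniversalEnvelopingAlgebra ℝ (Matrix (Fin k) (Fin k) (mixedSpace K))}
    (hq : envToMat K k (freeToEnveloping (archGroupGL k K) q) = ζ) {d : ℕ}
    {w : ℕ → FreeAlgebra ℝ (archGroupGL (k + l) K).lie} (hw : ∀ i, IsCentralWord (w i))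
    {C : ℕ → UniversalEnvelopingAlgebra ℝ (Matrix (Fin (k + l)) (Fin (k + l)) (mixedSpace K))}
    (hC : ∀ i, envToMat K (k + l) (freeToEnveloping (archGroupGL (k + l) K) (w i)) = C i)
    (hmem : HCLevi.jLeftR k l ζ ^ d + ∑ i ∈ Finset.range d, C i * HCLevi.jLeftR k l ζ ^ i ∈
      HCLevi.uRightR (𝕜 := mixedSpace K) k l)
    {a : ℕ → ℂ} (had : a d = 1)
    (ha : ∀ i < d, a i = θ ⟨freeToEnveloping (archGroupGL (k + l) K) (w i), hw i⟩)
    (m₂ : GL (Fin l) (AdeleRing (𝓞 K) K)) (m₁ : GL (Fin k) (AdeleRing (𝓞 K) K)) :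
    ∑ i ∈ Finset.range (d + 1), a i * applyFree (glArch k K) (q ^ i) (leviFunLeft ψ m₂) m₁ = 0 := by
  -- the hypothesis of `applyFree_pow_add_sum_eq_zero`
  set A : FreeAlgebra ℝ (archGroupGL (k + l) K).lie := liftInclLeft k l q with hA
  have hmem' : envToMat K (k + l) (freeToEnveloping (archGroupGL (k + l) K)
      (A ^ d + ∑ i ∈ Finset.range d, w i * A ^ i)) ∈ HCLevi.uRightR (𝕜 := mixedSpace K) k l := by
    simp only [hA, map_add, map_pow, map_mul, map_sum, envToMat_freeToEnveloping_liftInclLeft, hq, hC]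
    exact hmem
  have h := applyFree_pow_add_sum_eq_zero hψs hψN hθ A w hw hmem' (leviGL_mem_standardParabolicGL (m₁, m₂))
  -- transfer to the Levi
  have htr : ∀ i, applyFree (glArch k K) (q ^ i) (leviFunLeft ψ m₂) m₁ =
      applyFree (glArch (k + l) K) (A ^ i) ψ (leviGL (AdeleRing (𝓞 K) K) k l (m₁, m₂)) := by
    intro i
    rw [hA, ← map_pow (liftInclLeft k l) q i]
    exact congr_fun (applyFree_comp_leviGL_left (q ^ i) ψ m₂) m₁
  have hsum : ∑ i ∈ Finset.range d, a i * applyFree (glArch k K) (q ^ i) (leviFunLeft ψ m₂) m₁ =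
      ∑ i ∈ Finset.range d, θ ⟨freeToEnveloping (archGroupGL (k + l) K) (w i), hw i⟩ *
        applyFree (glArch (k + l) K) (A ^ i) ψ (leviGL (AdeleRing (𝓞 K) K) k l (m₁, m₂)) :=
    Finset.sum_congr rfl fun i hi => by simp only [ha i (Finset.mem_range.1 hi), htr]
  -- (`simp only`, not `rw`: a failed first-order match of `applyFree` must not unfold it)
  rw [Finset.sum_range_succ, had, one_mul, hsum]
  simp only [htr]
  rw [add_comm]
  exact h

set_option maxHeartbeats 400000 in
/-- **The `Z(𝔪)`-relation for the second Levi function** (abstract form, `diag(0, ζ)` and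
`liftInclRight`). [cite: MoeglinWaldspurger1995, I.2.17] -/
theorem sum_applyFree_pow_leviFunRight_eq_zero {ψ : GL (Fin (k + l)) (AdeleRing (𝓞 K) K) → ℂ}
    (hψs : IsArchSmooth (glArch (k + l) K) ψ)
    (hψN : ∀ (Y : blockNilpotent (k + l) k (AdeleRing (𝓞 K) K)) (g : GL (Fin (k + l)) (AdeleRing (𝓞 K) K)),
      ψ (unipotentOfBlock (k + l) k (AdeleRing (𝓞 K) K) (Multiplicative.ofAdd Y) * g) = ψ g)
    {θ : centerU (archGroupGL (k + l) K) →ₐ[ℝ] ℂ} (hθ : HasZCharacter (glArch (k + l) K) ψ θ)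
    {q : FreeAlgebra ℝ (archGroupGL l K).lie} {ζ : UniversalEnvelopingAlgebra ℝ (Matrix (Fin l) (Fin l) (mixedSpace K))}
    (hq : envToMat K l (freeToEnveloping (archGroupGL l K) q) = ζ) {d : ℕ}
    {w : ℕ → FreeAlgebra ℝ (archGroupGL (k + l) K).lie} (hw : ∀ i, IsCentralWord (w i))
    {C : ℕ → UniversalEnvelopingAlgebra ℝ (Matrix (Fin (k + l)) (Fin (k + l)) (mixedSpace K))}
    (hC : ∀ i, envToMat K (k + l) (freeToEnveloping (archGroupGL (k + l) K) (w i)) = C i)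
    (hmem : HCLevi.jRightR k l ζ ^ d + ∑ i ∈ Finset.range d, C i * HCLevi.jRightR k l ζ ^ i ∈
      HCLevi.uRightR (𝕜 := mixedSpace K) k l)
    {a : ℕ → ℂ} (had : a d = 1)
    (ha : ∀ i < d, a i = θ ⟨freeToEnveloping (archGroupGL (k + l) K) (w i), hw i⟩)
    (m₁ : GL (Fin k) (AdeleRing (𝓞 K) K)) (m₂ : GL (Fin l) (AdeleRing (𝓞 K) K)) :
    ∑ i ∈ Finset.range (d + 1), a i * applyFree (glArch l K) (q ^ i) (leviFunRight ψ m₁) m₂ = 0 := by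
  set A : FreeAlgebra ℝ (archGroupGL (k + l) K).lie := liftInclRight k l q with hA
  have hmem' : envToMat K (k + l) (freeToEnveloping (archGroupGL (k + l) K)
      (A ^ d + ∑ i ∈ Finset.range d, w i * A ^ i)) ∈ HCLevi.uRightR (𝕜 := mixedSpace K) k l := by
    simp only [hA, map_add, map_pow, map_mul, map_sum, envToMat_freeToEnveloping_liftInclRight, hq, hC]
    exact hmem
  have h := applyFree_pow_add_sum_eq_zero hψs hψN hθ A w hw hmem' (leviGL_mem_standardParabolicGL (m₁, m₂))
  have htr : ∀ i, applyFree (glArch l K) (q ^ i) (leviFunRight ψ m₁) m₂ =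
      applyFree (glArch (k + l) K) (A ^ i) ψ (leviGL (AdeleRing (𝓞 K) K) k l (m₁, m₂)) := by
    intro i
    rw [hA, ← map_pow (liftInclRight k l) q i]
    exact congr_fun (applyFree_comp_leviGL_right (q ^ i) ψ m₁) m₂
  have hsum : ∑ i ∈ Finset.range d, a i * applyFree (glArch l K) (q ^ i) (leviFunRight ψ m₁) m₂ =
      ∑ i ∈ Finset.range d, θ ⟨freeToEnveloping (archGroupGL (k + l) K) (w i), hw i⟩ *
        applyFree (glArch (k + l) K) (A ^ i) ψ (leviGL (AdeleRing (𝓞 K) K) k l (m₁, m₂)) :=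
    Finset.sum_congr rfl fun i hi => by simp only [ha i (Finset.mem_range.1 hi), htr]
  -- (`simp only`, not `rw`: a failed first-order match of `applyFree` must not unfold it)
  rw [Finset.sum_range_succ, had, one_mul, hsum]
  simp only [htr]
  rw [add_comm]
  exact h

end Levi

/-! ### 5. The relations for the Levi functions of constant terms of automorphic forms, place by place -/

section Places

variable [MeasurableSpace (AdeleRing (𝓞 K) K)] [BorelSpace (AdeleRing (𝓞 K) K)]

/-- The constant term of an automorphic form of character `θ` along `P_k`: smooth, left
`N_k(𝔸_K)`-invariant and of character `θ` (`IsAutomorphicForm.isArchSmooth_blockCT`,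
`IsLeftInvariant.blockCT_unipotentOfBlock_mul`, `HasZCharacter.blockCT`). [cite: MoeglinWaldspurger1995, I.2.6] -/
theorem blockCT_smooth_unipotent_character {hcpt : isCompact_glFiniteIntegralLevel (k + l) K}
    {φ : (AdelicGroupData.gl (k + l) K).Adelic → ℂ} (hφ : IsAutomorphicForm (AutomorphyDatum.gl (k + l) K hcpt) φ)
    {θ : centerU (archGroupGL (k + l) K) →ₐ[ℝ] ℂ} (hθ : HasZCharacter (glArch (k + l) K) φ θ)
    (ν : Measure (BlockIdx (k + l) k → AdeleRing (𝓞 K) K)) [ν.IsAddHaarMeasure] :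
    IsArchSmooth (glArch (k + l) K) (blockCT (le_refl (k + l)) k ν φ) ∧
      (∀ (Y : blockNilpotent (k + l) k (AdeleRing (𝓞 K) K)) (g : GL (Fin (k + l)) (AdeleRing (𝓞 K) K)),
        blockCT (le_refl (k + l)) k ν φ (unipotentOfBlock (k + l) k (AdeleRing (𝓞 K) K) (Multiplicative.ofAdd Y) * g) =
          blockCT (le_refl (k + l)) k ν φ g) ∧
      HasZCharacter (glArch (k + l) K) (blockCT (le_refl (k + l)) k ν φ) θ := by
  obtain ⟨U, hU, hφU⟩ := hφ.exists_level
  exact ⟨hφ.isArchSmooth_blockCT ν,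
    fun Y g => IsLeftInvariant.blockCT_unipotentOfBlock_mul hφ.continuous_gl hφ.leftInvariant ν Y g,
    hθ.blockCT hφ.leftInvariant hφ.archSmooth hU hφU ν⟩

/-- **The `Z(𝔪)`-relation at a real place, first Levi block.** For a real place `w`, a central
`z ∈ Z(U(𝔤𝔩_k(ℝ)))` and a character `θ` of `Z(𝔤𝔩_{k+l}(K_∞))` there is a monic real polynomial `Q`
such that, for every automorphic form `φ` on `GL_{k+l}(𝔸_K)` of character `θ`, every additive Haar
measure `ν` on the box and every `m₂ ∈ GL_l(𝔸_K)`, every word over `𝔤𝔩_k(K_∞)` whose image in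
`U(𝔤𝔩_k(K_∞))` is a multiple of `Q(z_w)` (`z_w` the image of `z` at the place `w`) kills the Levi
function `leviFunLeft φ_P m₂`. Harish-Chandra 1968, §4, Thm. 4 and Cor.; Moeglin–Waldspurger 1995,
I.2.17; Borel–Jacquet 1979, 4.4. [cite: MoeglinWaldspurger1995, I.2.17] -/
theorem exists_monic_forall_leviFunLeft_realPlace {hcpt : isCompact_glFiniteIntegralLevel (k + l) K}
    (w : {w : InfinitePlace K // InfinitePlace.IsReal w})
    {z : UniversalEnvelopingAlgebra ℝ (Matrix (Fin k) (Fin k) ℝ)}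
    (hz : z ∈ Subalgebra.center ℝ (UniversalEnvelopingAlgebra ℝ (Matrix (Fin k) (Fin k) ℝ)))
    (θ : centerU (archGroupGL (k + l) K) →ₐ[ℝ] ℂ) :
    ∃ Q : ℝ[X], Q.Monic ∧
      ∀ {φ : (AdelicGroupData.gl (k + l) K).Adelic → ℂ}, IsAutomorphicForm (AutomorphyDatum.gl (k + l) K hcpt) φ →
        HasZCharacter (glArch (k + l) K) φ θ →
        ∀ (ν : Measure (BlockIdx (k + l) k → AdeleRing (𝓞 K) K)) [ν.IsAddHaarMeasure]
          (m₂ : GL (Fin l) (AdeleRing (𝓞 K) K)) {p : FreeAlgebra ℝ (archGroupGL k K).lie}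
          {r : UniversalEnvelopingAlgebra ℝ (archGroupGL k K).lie},
          freeToEnveloping (archGroupGL k K) p =
            r * Polynomial.aeval (envOfMat K k (HCLevi.mapU (realPlaceHom w) k z)) Q →
          applyFree (glArch k K) p (leviFunLeft (blockCT (le_refl (k + l)) k ν φ) m₂) = 0 := by
  obtain ⟨d, c, hc, hrel⟩ := HCLevi.exists_monic_mem_uRightR_realPlace_jLeftR k l w z hz
  -- words representing `z_w` and the `C_i`
  obtain ⟨q, hq⟩ := freeToEnveloping_surjective_gl (K := K) k (envOfMat K k (HCLevi.mapU (realPlaceHom w) k z))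
  choose wd hwd using fun i => freeToEnveloping_surjective_gl (K := K) (k + l)
    (envOfMat K (k + l) (HCLevi.mapU (realPlaceHom w) (k + l) (c i)))
  have hwc : ∀ i, IsCentralWord (wd i) := fun i => by
    rw [IsCentralWord, hwd]; exact envOfMat_mem_center (HCLevi.mapU_realPlace_mem_center w (hc i))
  -- the coefficients
  set a : ℕ → ℂ := fun i => if i = d then 1 else θ ⟨freeToEnveloping (archGroupGL (k + l) K) (wd i), hwc i⟩ with ha_def
  have had : a d = 1 := if_pos rfl
  have ha : ∀ i < d, a i = θ ⟨freeToEnveloping (archGroupGL (k + l) K) (wd i), hwc i⟩ := fun i hi => if_neg hi.ne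
  refine ⟨normPoly a d, normPoly_monic had, ?_⟩
  intro φ hφ hθ ν _ m₂ p r hp
  obtain ⟨hψs, hψN, hψθ⟩ := blockCT_smooth_unipotent_character hφ hθ ν
  have hrel' := sum_applyFree_pow_leviFunLeft_eq_zero hψs hψN hψθ (q := q)
    (by rw [hq, envToMat_envOfMat]) hwc (fun i => by rw [hwd, envToMat_envOfMat]) hrel had ha m₂
  refine applyFree_eq_zero_of_sum_applyFree_pow_eq_zero (glArch k K) (isArchSmooth_leviFunLeft hψs m₂) q a d
    hrel' (r := r) ?_
  rw [hp, hq]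

/-- **The `Z(𝔪)`-relation at a real place, second Levi block.** [cite: MoeglinWaldspurger1995, I.2.17] -/
theorem exists_monic_forall_leviFunRight_realPlace {hcpt : isCompact_glFiniteIntegralLevel (k + l) K}
    (w : {w : InfinitePlace K // InfinitePlace.IsReal w})
    {z : UniversalEnvelopingAlgebra ℝ (Matrix (Fin l) (Fin l) ℝ)}
    (hz : z ∈ Subalgebra.center ℝ (UniversalEnvelopingAlgebra ℝ (Matrix (Fin l) (Fin l) ℝ)))
    (θ : centerU (archGroupGL (k + l) K) →ₐ[ℝ] ℂ) :
    ∃ Q : ℝ[X], Q.Monic ∧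
      ∀ {φ : (AdelicGroupData.gl (k + l) K).Adelic → ℂ}, IsAutomorphicForm (AutomorphyDatum.gl (k + l) K hcpt) φ →
        HasZCharacter (glArch (k + l) K) φ θ →
        ∀ (ν : Measure (BlockIdx (k + l) k → AdeleRing (𝓞 K) K)) [ν.IsAddHaarMeasure]
          (m₁ : GL (Fin k) (AdeleRing (𝓞 K) K)) {p : FreeAlgebra ℝ (archGroupGL l K).lie}
          {r : UniversalEnvelopingAlgebra ℝ (archGroupGL l K).lie},
          freeToEnveloping (archGroupGL l K) p =
            r * Polynomial.aeval (envOfMat K l (HCLevi.mapU (realPlaceHom w) l z)) Q →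
          applyFree (glArch l K) p (leviFunRight (blockCT (le_refl (k + l)) k ν φ) m₁) = 0 := by
  obtain ⟨d, c, hc, hrel⟩ := HCLevi.exists_monic_mem_uRightR_realPlace_jRightR k l w z hz
  obtain ⟨q, hq⟩ := freeToEnveloping_surjective_gl (K := K) l (envOfMat K l (HCLevi.mapU (realPlaceHom w) l z))
  choose wd hwd using fun i => freeToEnveloping_surjective_gl (K := K) (k + l)
    (envOfMat K (k + l) (HCLevi.mapU (realPlaceHom w) (k + l) (c i)))
  have hwc : ∀ i, IsCentralWord (wd i) := fun i => by
    rw [IsCentralWord, hwd]; exact envOfMat_mem_center (HCLevi.mapU_realPlace_mem_center w (hc i))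
  set a : ℕ → ℂ := fun i => if i = d then 1 else θ ⟨freeToEnveloping (archGroupGL (k + l) K) (wd i), hwc i⟩ with ha_def
  have had : a d = 1 := if_pos rfl
  have ha : ∀ i < d, a i = θ ⟨freeToEnveloping (archGroupGL (k + l) K) (wd i), hwc i⟩ := fun i hi => if_neg hi.ne
  refine ⟨normPoly a d, normPoly_monic had, ?_⟩
  intro φ hφ hθ ν _ m₁ p r hp
  obtain ⟨hψs, hψN, hψθ⟩ := blockCT_smooth_unipotent_character hφ hθ ν
  have hrel' := sum_applyFree_pow_leviFunRight_eq_zero hψs hψN hψθ (q := q)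
    (by rw [hq, envToMat_envOfMat]) hwc (fun i => by rw [hwd, envToMat_envOfMat]) hrel had ha m₁
  refine applyFree_eq_zero_of_sum_applyFree_pow_eq_zero (glArch l K) (isArchSmooth_leviFunRight hψs m₁) q a d
    hrel' (r := r) ?_
  rw [hp, hq]

/-- **The `Z(𝔪)`-relation at a complex place, first Levi block.** [cite: MoeglinWaldspurger1995, I.2.17] -/
theorem exists_monic_forall_leviFunLeft_complexPlace {hcpt : isCompact_glFiniteIntegralLevel (k + l) K}
    (w : {w : InfinitePlace K // InfinitePlace.IsComplex w})
    {z : UniversalEnvelopingAlgebra ℝ (Matrix (Fin k) (Fin k) ℂ)}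
    (hz : z ∈ Subalgebra.center ℝ (UniversalEnvelopingAlgebra ℝ (Matrix (Fin k) (Fin k) ℂ)))
    (θ : centerU (archGroupGL (k + l) K) →ₐ[ℝ] ℂ) :
    ∃ Q : ℝ[X], Q.Monic ∧
      ∀ {φ : (AdelicGroupData.gl (k + l) K).Adelic → ℂ}, IsAutomorphicForm (AutomorphyDatum.gl (k + l) K hcpt) φ →
        HasZCharacter (glArch (k + l) K) φ θ →
        ∀ (ν : Measure (BlockIdx (k + l) k → AdeleRing (𝓞 K) K)) [ν.IsAddHaarMeasure]
          (m₂ : GL (Fin l) (AdeleRing (𝓞 K) K)) {p : FreeAlgebra ℝ (archGroupGL k K).lie}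
          {r : UniversalEnvelopingAlgebra ℝ (archGroupGL k K).lie},
          freeToEnveloping (archGroupGL k K) p =
            r * Polynomial.aeval (envOfMat K k (HCLevi.mapU (complexPlaceHom w) k z)) Q →
          applyFree (glArch k K) p (leviFunLeft (blockCT (le_refl (k + l)) k ν φ) m₂) = 0 := by
  obtain ⟨d, c, hc, hrel⟩ := HCLevi.exists_monic_mem_uRightR_complexPlace_jLeftR k l w z hz
  obtain ⟨q, hq⟩ := freeToEnveloping_surjective_gl (K := K) k (envOfMat K k (HCLevi.mapU (complexPlaceHom w) k z))
  choose wd hwd using fun i => freeToEnveloping_surjective_gl (K := K) (k + l)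
    (envOfMat K (k + l) (HCLevi.mapU (complexPlaceHom w) (k + l) (c i)))
  have hwc : ∀ i, IsCentralWord (wd i) := fun i => by
    rw [IsCentralWord, hwd]; exact envOfMat_mem_center (HCLevi.mapU_complexPlace_mem_center w (hc i))
  set a : ℕ → ℂ := fun i => if i = d then 1 else θ ⟨freeToEnveloping (archGroupGL (k + l) K) (wd i), hwc i⟩ with ha_def
  have had : a d = 1 := if_pos rfl
  have ha : ∀ i < d, a i = θ ⟨freeToEnveloping (archGroupGL (k + l) K) (wd i), hwc i⟩ := fun i hi => if_neg hi.ne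
  refine ⟨normPoly a d, normPoly_monic had, ?_⟩
  intro φ hφ hθ ν _ m₂ p r hp
  obtain ⟨hψs, hψN, hψθ⟩ := blockCT_smooth_unipotent_character hφ hθ ν
  have hrel' := sum_applyFree_pow_leviFunLeft_eq_zero hψs hψN hψθ (q := q)
    (by rw [hq, envToMat_envOfMat]) hwc (fun i => by rw [hwd, envToMat_envOfMat]) hrel had ha m₂
  refine applyFree_eq_zero_of_sum_applyFree_pow_eq_zero (glArch k K) (isArchSmooth_leviFunLeft hψs m₂) q a d
    hrel' (r := r) ?_
  rw [hp, hq]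

/-- **The `Z(𝔪)`-relation at a complex place, second Levi block.** [cite: MoeglinWaldspurger1995, I.2.17] -/
theorem exists_monic_forall_leviFunRight_complexPlace {hcpt : isCompact_glFiniteIntegralLevel (k + l) K}
    (w : {w : InfinitePlace K // InfinitePlace.IsComplex w})
    {z : UniversalEnvelopingAlgebra ℝ (Matrix (Fin l) (Fin l) ℂ)}
    (hz : z ∈ Subalgebra.center ℝ (UniversalEnvelopingAlgebra ℝ (Matrix (Fin l) (Fin l) ℂ)))
    (θ : centerU (archGroupGL (k + l) K) →ₐ[ℝ] ℂ) :
    ∃ Q : ℝ[X], Q.Monic ∧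
      ∀ {φ : (AdelicGroupData.gl (k + l) K).Adelic → ℂ}, IsAutomorphicForm (AutomorphyDatum.gl (k + l) K hcpt) φ →
        HasZCharacter (glArch (k + l) K) φ θ →
        ∀ (ν : Measure (BlockIdx (k + l) k → AdeleRing (𝓞 K) K)) [ν.IsAddHaarMeasure]
          (m₁ : GL (Fin k) (AdeleRing (𝓞 K) K)) {p : FreeAlgebra ℝ (archGroupGL l K).lie}
          {r : UniversalEnvelopingAlgebra ℝ (archGroupGL l K).lie},
          freeToEnveloping (archGroupGL l K) p =
            r * Polynomial.aeval (envOfMat K l (HCLevi.mapU (complexPlaceHom w) l z)) Q →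
          applyFree (glArch l K) p (leviFunRight (blockCT (le_refl (k + l)) k ν φ) m₁) = 0 := by
  obtain ⟨d, c, hc, hrel⟩ := HCLevi.exists_monic_mem_uRightR_complexPlace_jRightR k l w z hz
  obtain ⟨q, hq⟩ := freeToEnveloping_surjective_gl (K := K) l (envOfMat K l (HCLevi.mapU (complexPlaceHom w) l z))
  choose wd hwd using fun i => freeToEnveloping_surjective_gl (K := K) (k + l)
    (envOfMat K (k + l) (HCLevi.mapU (complexPlaceHom w) (k + l) (c i)))
  have hwc : ∀ i, IsCentralWord (wd i) := fun i => by
    rw [IsCentralWord, hwd]; exact envOfMat_mem_center (HCLevi.mapU_complexPlace_mem_center w (hc i))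
  set a : ℕ → ℂ := fun i => if i = d then 1 else θ ⟨freeToEnveloping (archGroupGL (k + l) K) (wd i), hwc i⟩ with ha_def
  have had : a d = 1 := if_pos rfl
  have ha : ∀ i < d, a i = θ ⟨freeToEnveloping (archGroupGL (k + l) K) (wd i), hwc i⟩ := fun i hi => if_neg hi.ne
  refine ⟨normPoly a d, normPoly_monic had, ?_⟩
  intro φ hφ hθ ν _ m₁ p r hp
  obtain ⟨hψs, hψN, hψθ⟩ := blockCT_smooth_unipotent_character hφ hθ ν
  have hrel' := sum_applyFree_pow_leviFunRight_eq_zero hψs hψN hψθ (q := q)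
    (by rw [hq, envToMat_envOfMat]) hwc (fun i => by rw [hwd, envToMat_envOfMat]) hrel had ha m₁
  refine applyFree_eq_zero_of_sum_applyFree_pow_eq_zero (glArch l K) (isArchSmooth_leviFunRight hψs m₁) q a d
    hrel' (r := r) ?_
  rw [hp, hq]

end Places

end Literature.NumberTheory.Automorphic
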